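import Mathlib
import HarnessLib
import Summits.AnomalousDissipation.AnomalousDissipation.Theses.LimitingAbsorption

/-!
# Birth skeleton (BC3) for the crux `LimitingAbsorption.RelaxingFamily`
(item stmt-AnomalousDissipation-15009; route route-AnomalousDissipation-LimitingAbsorption, crux r3) —
skeleton registrar planner-skel-stmt-AnomalousDissipation-15009-0, 2026-08-17.

The crux (`Summit.AnomalousDissipation.AnomalousDissipation.Theses.LimitingAbsorption.RelaxingFamily`):
there are a steady smooth divergence-free mean-zero `g`, a smooth mean-zero `h ≠ 0`, `ν_j → 0`, a
bounded-energy, locally bounded global planar Leray–Hopf family `v_j` (force `g`) and ONE pair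
`(C, γ)` with (U_h): from every phase `s ≥ 0`, every weak solution of
`∂ₜθ + v_j(s+·)·∇θ = ν_j Δθ`, `θ(0) = h`, obeys `‖θ(t)‖² ≤ C e^{-γt} ‖h‖²` for a.e. `t`.

## The seam: a uniform DISSIPATION TIME on an invariant data class × the cocycle upgrade

No stirring mechanism proves exponential decay of ONE profile directly. What a construction delivers
(Feng–Iyer 2019 "dissipation time"; Coti Zelati–Delgadino–Elgindi 2020; Hess-Childs–Rowan 2025b,
arXiv:2508.00115, Cor. 1.2) is a UNIFORM ONE-STEP CONTRACTION `‖θ(t)‖² ≤ δ ‖θ₀‖²` for `t ≥ τ` on a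
class of data closed under the evolution; exponential decay then follows by restarting. The crux's
clause (U_h) is cut along exactly that seam — two registered stubs:

* `stub_contractingStates` (Navier–Stokes side; the residue of the crux, open, size XL). The crux's NS
  clauses verbatim (steady smooth `g`, smooth mean-zero `h ≠ 0`, `ν_j → 0`, global Leray–Hopf `v_j`,
  locally bounded, `sup_j meanEnergy ≤ E`) and, at every level `j`, a class `𝒮 j ∋ h` of `L²` data
  which is INVARIANT under every scalar evolution `∂ₜ + v_j(s+·)·∇ − ν_jΔ` (a.e. slices of every weak
  solution released from a datum in `𝒮 j` at any phase `s ≥ 0` lie in `𝒮 j`) and on which the family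
  has a `j`-UNIFORM, PHASE-UNIFORM DISSIPATION TIME: one lag `τ > 0` and one factor `0 ≤ δ < 1` with
  `‖θ(t)‖² ≤ δ ‖θ₀‖²` for a.e. `t ≥ τ`, for every datum `θ₀ ∈ 𝒮 j`, every phase, every level.
  This is NOT the crux reworded: it is a ratio-to-CURRENT-norm clause on a class (a cocycle contraction),
  which (U_h) — a decay envelope for the single orbit of `h`, relative to `‖h‖` — does not give back
  (an orbit may plateau at small amplitude), and which gives (U_h) back only through the second stub.
  Intended instance (NOT decomposed, D-0019; lemmas ride with `--supports`): `𝒮 j` = the odd sector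
  `{θ₀ ∈ L² : θ₀(−x) = −θ₀(x) a.e.}` of a centrally ODD design — `g(−x) = −g(x)`, odd data `v₀ j` —
  since planar NS propagates oddness of `v_j`, the scalar equation with an odd drift propagates oddness
  of `θ` (invariance = symmetry of the weak formulation + bounded-drift uniqueness), while `curl g` and
  `ω_j = curl v_j` are EVEN: the Prandtl-one passenger `ω_j` (which any ALL-DATA dissipation time would
  relax, forcing `j`-uniformly bounded late enstrophy — excluded by the landed
  `relaxingFamily_false_without_unboundedEnstrophy`; STRATEGY-CENSUS §3 S⁺₃, §4 D-a(1)) is exempt.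
  Intermittent ("bursty") stirring is admissible: contraction is asked only after the lag `τ`, which may
  exceed the recurrence time of the mixing events, because `L²` norms never grow in between.
* `stub_contractionUpgrade` (kinematic, NS-free; TRUE in print, size M–L in Lean). For `κ > 0` and a
  drift essentially bounded on every `(0,T) × T²`, invariance of `𝒮 ⊆ L²` plus a uniform dissipation
  time `(τ, δ)` on `𝒮` give the crux's exponential clause for EVERY datum in `𝒮` from EVERY phase with
  constants `(C, γ)` depending on `(τ, δ)` ONLY (e.g. `γ = log(1/δ)/τ`, `C = 1/δ` for `δ > 0`) — the
  evolution-family form of the easy direction of Datko–Pazy (Pazy 1983, Ch. 4 §4.4 Thm 4.1). Proof in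
  print: restart the weak solution at a.e. time `t₁` (restart lemma for `L^∞_t L²_x` weak solutions:
  tests `η_ε(t)ψ(t − t₁)`, Lebesgue points of `t ↦ θ(t) ∈ L²`; the shift bookkeeping is in
  `Theorems/LimitingAbsorptionRelaxationBoundsInventoryShift.lean`), contract once per block of length
  `τ` along ONE good restart point per step (`⌊t/τ⌋` steps), and fill `t < τ` with the energy
  inequality `‖θ(t)‖² ≤ ‖θ₀‖²` (`Literature…IsWeakScalarTransportOn.lintegral_sq_add_le`, proved in
  tree as `lintegral_sq_add_le_holds`: bounded drift, `L²` datum, `κ > 0`).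

`RelaxingFamily_of : Sig.stub_contractingStates → Sig.stub_contractionUpgrade → RelaxingFamily`
concludes the route decl BY NAME (hypothesis heads = stub names) and is proved sorry-free; the
constants handed to the crux are level-independent because the upgrade's `(C, γ)` depend on `(τ, δ)`
only. `RelaxingFamily_proof : RelaxingFamily` is the skeleton in its final shape (depends on `sorryAx`
through the two stubs only).

## Disproof used (`Cruxes/RelaxingFamily/Disproof.lean`, cdisprove cycle 1; read 2026-08-17)

Every landed `Theorems/RelaxingFamily/Negative/*` theorem has the shape `¬ RelaxingFamilyUnder <class>`.
Since `stub_contractingStates ∧ stub_contractionUpgrade` yields the crux with the SAME `(g, h, ν, v)`,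
each obstruction is honoured AT `stub_contractingStates` ("the line uses H at stub 1"): a witness must
force at least two Fourier shells (`relaxingFamily_false_without_multiShell`), have `g ≠ 0`
(`relaxingFamily_false_without_forcing`), dissipate infinite total enstrophy at all but finitely many
levels (`relaxingFamily_false_without_infiniteEnstrophyDissipation(_frequently)`), and carry windowed
mean `‖∇v_j‖₂ ≳ γ·log(1/ν_j)` from every phase at bounded energy, with `γ = log(1/δ)/τ`
(`relaxingFamily_false_without_superlinearEnstrophy / unboundedEnstrophy / superlinearMeanEnstrophy`,
`relaxingFamily_false_without_logEnstrophy(_liminf)`; Seis 2022 Rmk 1, in tree as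
`Literature.Analysis.FluidPDE.Seis2022_rmk1_L2_holds`). The near-rigorous S⁺₃ no-go
(`Cruxes/RelaxingFamily/SketchStrategist.lean` `allData_noGoTarget`; Disproof N2 `collinearTorque_noGo`)
is honoured by `𝒮 j` being a proper invariant class avoiding `curl g` (it must not be all of `L²₀`).
Dead line `Lines/Sketch.lean` (`stub_hull` ≡ the crux in hull form) is avoided: neither stub here is
the crux or the summit reworded (BC3 probes below), and the kinematic stub is a universally quantified
theorem, not an existence claim. `ledger negatives --problem AnomalousDissipation` (6 statements,
2026-08-17): none equal or trivially equivalent to either stub.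

## BC3 audit (this seat; raw outputs in the seat's NOTES.md `birth-certificate:`)

`lean check --json` rc 0 with `sorry` exactly in `stub_contractingStates`, `stub_contractionUpgrade`
(sorry count 2 = stub count, zero elsewhere); probes `stub → RelaxingFamily` and
`stub → AnomalousDissipation` by `first | exact? | simpa [stub] | (unfold stub; simpa) | aesop` FAIL for
both stubs (4/4), file `bc/RelaxingFamily_stub_probes.lean` of the seat folder.
-/

set_option linter.dupNamespace false

noncomputable section

namespace Summit.AnomalousDissipation.AnomalousDissipation.Cruxes.RelaxingFamily.Birth

open MeasureTheory Set Filter Topology Function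
open Literature.Analysis.FunctionSpaces Literature.Analysis.FunctionSpaces.Torus
open Literature.Analysis.FluidPDE Literature.Analysis.FluidPDE.Torus
open Summit.AnomalousDissipation.AnomalousDissipation.Theses.LimitingAbsorption

/-- The unit flat 2-torus (local notation). -/
local notation "𝕋²" => UnitAddTorus (Fin 2)
/-- Planar vectors (local notation). -/
local notation "E²" => EuclideanSpace ℝ (Fin 2)

/-! ### Vocabulary of the seam (plain `def`s over tree declarations) -/

/-- `InvariantOn κ u 𝒮`: the data class `𝒮` is invariant under the scalar evolution
`∂ₜ + u(s+·)·∇ − κΔ` from every phase `s ≥ 0` — almost every time slice of every weak solution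
(`Torus.IsWeakScalarTransportOn`, class `L^∞_t L²_x`) released from a datum in `𝒮` lies in `𝒮`. -/
def InvariantOn (κ : ℝ) (u : ℝ → 𝕋² → E²) (𝒮 : Set (𝕋² → ℝ)) : Prop :=
  ∀ s : ℝ, 0 ≤ s → ∀ θ₀ ∈ 𝒮, ∀ (T : ℝ) (θ : ℝ → 𝕋² → ℝ),
    IsWeakScalarTransportOn T κ (fun t => u (s + t)) θ₀ θ →
      ∀ᵐ t ∂(volume.restrict (Ioo (0 : ℝ) T)), θ t ∈ 𝒮

/-- `ContractsOn κ u 𝒮 τ δ`: a uniform ONE-STEP CONTRACTION (dissipation time `τ`, factor `δ`) on the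
class `𝒮`, from every phase `s ≥ 0`: every weak solution released from a datum `θ₀ ∈ 𝒮` has
`‖θ(t)‖²_{L²} ≤ δ ‖θ₀‖²_{L²}` for a.e. `t ≥ τ` of its horizon. -/
def ContractsOn (κ : ℝ) (u : ℝ → 𝕋² → E²) (𝒮 : Set (𝕋² → ℝ)) (τ δ : ℝ) : Prop :=
  ∀ s : ℝ, 0 ≤ s → ∀ θ₀ ∈ 𝒮, ∀ (T : ℝ) (θ : ℝ → 𝕋² → ℝ),
    IsWeakScalarTransportOn T κ (fun t => u (s + t)) θ₀ θ →
      ∀ᵐ t ∂(volume.restrict (Ioo (0 : ℝ) T)), τ ≤ t → scalarL2Sq (θ t) ≤ δ * scalarL2Sq θ₀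

/-- `RelaxesFrom κ u θ₀ C γ`: the crux's exponential clause for the datum `θ₀` at one level — from
every phase `s ≥ 0`, every weak solution released from `θ₀` has `‖θ(t)‖² ≤ C e^{-γ t} ‖θ₀‖²` for
a.e. `t` (with `θ₀ = h`, `κ = ν j`, `u = v j` this is literally the last conjunct of `RelaxingFamily`
at level `j`). -/
def RelaxesFrom (κ : ℝ) (u : ℝ → 𝕋² → E²) (θ₀ : 𝕋² → ℝ) (C γ : ℝ) : Prop :=
  ∀ s : ℝ, 0 ≤ s → ∀ (T : ℝ) (θ : ℝ → 𝕋² → ℝ),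
    IsWeakScalarTransportOn T κ (fun t => u (s + t)) θ₀ θ →
      ∀ᵐ t ∂(volume.restrict (Ioo (0 : ℝ) T)),
        scalarL2Sq (θ t) ≤ C * Real.exp (-(γ * t)) * scalarL2Sq θ₀

/-! ### Stub signatures (`Sig.stub_*`, so that the hypothesis heads of `RelaxingFamily_of` carry the
registered stub names) -/

/-- STUB 1 — NS-REALISED UNIFORM DISSIPATION TIME ON AN INVARIANT CLASS THROUGH `h` (the residue of the
crux; open, size XL). A steady smooth divergence-free mean-zero force `g`, a smooth mean-zero profile
`h ≠ 0`, viscosities `ν_j → 0`, data `v₀ j` and global planar Leray–Hopf solutions `v j` (force `g`),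
essentially bounded on every `(0,T) × T²`, with `sup_j meanEnergy (v j) ≤ E`; and, level by level, a
class `𝒮 j` of `L²` data containing `h`, invariant under every scalar evolution of the level
(`InvariantOn`), on which ONE lag `τ > 0` and ONE factor `δ ∈ [0,1)` give the one-step contraction
`ContractsOn (ν j) (v j) (𝒮 j) τ δ` at every level. Why it might fail = why the crux might: Seis' floor
forces windowed mean `‖∇v_j‖₂ ≳ (log(1/δ)/τ) log(1/ν_j)` from every phase at bounded energy
(Kraichnan–Batchelor predicts `log^{1/3}`); and `𝒮 j` must dodge the even/vorticity sector
(Prandtl-one passenger). Sources: FengIyer2019, ZelatiDelgadinoElgindi2019 (dissipation time),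
HessChildsRowan2025b (arXiv:2508.00115) Cor. 1.2 (kinematic sibling), Seis2022 Rmk 1,
STRATEGY-CENSUS.md §3–4 of this crux. -/
def Sig.stub_contractingStates : Prop :=
  ∃ (g : 𝕋² → E²) (h : 𝕋² → ℝ), IsSmooth g ∧ IsDivFree g ∧ HasZeroMean g ∧
    IsSmooth h ∧ HasZeroMean h ∧ h ≠ 0 ∧
    ∃ (ν : ℕ → ℝ) (v₀ : ℕ → 𝕋² → E²) (v : ℕ → ℝ → 𝕋² → E²),
      (∀ j, 0 < ν j) ∧ Tendsto ν atTop (𝓝 0) ∧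
      (∀ j, IsGlobalLerayHopf (ν j) (fun _ => g) (v₀ j) (v j)) ∧
      (∀ j (T : ℝ), 0 < T → MemLp (stLift (v j)) ⊤ (volume.restrict (Ioo (0 : ℝ) T ×ˢ univ))) ∧
      (∃ E : ℝ, ∀ j, meanEnergy (v j) ≤ E) ∧
      ∃ (𝒮 : ℕ → Set (𝕋² → ℝ)) (τ δ : ℝ),
        (∀ j, h ∈ 𝒮 j) ∧ (∀ j, ∀ θ₀ ∈ 𝒮 j, MemLp θ₀ 2 volume) ∧
        0 < τ ∧ 0 ≤ δ ∧ δ < 1 ∧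
        (∀ j, InvariantOn (ν j) (v j) (𝒮 j)) ∧
        (∀ j, ContractsOn (ν j) (v j) (𝒮 j) τ δ)

/-- STUB 2 — THE COCYCLE UPGRADE: UNIFORM DISSIPATION TIME ⇒ PHASE-UNIFORM EXPONENTIAL RELAXATION IN
THE WEAK CLASS (kinematic, NS-free; true in print, size M–L). For every lag `τ > 0` and factor
`δ ∈ [0,1)` there are `C ≥ 0`, `γ > 0` — depending on `(τ, δ)` ONLY — such that for every diffusivity
`κ > 0`, every drift `u` essentially bounded on every `(0,T) × T²`, and every class `𝒮 ⊆ L²` that is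
invariant (`InvariantOn κ u 𝒮`) and uniformly contracted (`ContractsOn κ u 𝒮 τ δ`), every datum
`θ₀ ∈ 𝒮` relaxes exponentially from every phase: `RelaxesFrom κ u θ₀ C γ`. Proof in print: restart at
a.e. time (restart lemma for `L^∞_t L²_x` weak solutions), iterate the contraction `⌊t/τ⌋` times along
one good restart point per step, energy inequality (`lintegral_sq_add_le_holds`) on `[0, τ)`;
`γ = log(1/δ)/τ`, `C = δ⁻¹` (`δ > 0`), resp. any `γ` with `C = e^{γτ}` (`δ = 0`). Sources: Pazy1983
Ch. 4 §4.4 Thm 4.1 (Datko–Pazy, easy direction), in tree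
`Theorems/LimitingAbsorptionRelaxationBoundsInventoryShift.lean` (time shifts, part I),
`Theorems/RelaxingFamily/Negative/GlobalWeakScalar.lean` (slice congruence, gluing). -/
def Sig.stub_contractionUpgrade : Prop :=
  ∀ (τ δ : ℝ), 0 < τ → 0 ≤ δ → δ < 1 →
    ∃ C γ : ℝ, 0 ≤ C ∧ 0 < γ ∧
      ∀ (κ : ℝ) (u : ℝ → 𝕋² → E²) (𝒮 : Set (𝕋² → ℝ)), 0 < κ →
        (∀ T : ℝ, 0 < T → MemLp (stLift u) ⊤ (volume.restrict (Ioo (0 : ℝ) T ×ˢ univ))) →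
        (∀ θ₀ ∈ 𝒮, MemLp θ₀ 2 volume) →
        InvariantOn κ u 𝒮 → ContractsOn κ u 𝒮 τ δ →
          ∀ θ₀ ∈ 𝒮, RelaxesFrom κ u θ₀ C γ

/-! ### Registered stubs -/

/-- Registered stub 1 (NS side — the residue; load-bearing, hardest). -/
theorem stub_contractingStates : Sig.stub_contractingStates := by
  sorry

/-- Registered stub 2 (kinematic cocycle upgrade — true in print; the Lean work is the a.e.-time
restart lemma for weak scalar transport). -/
theorem stub_contractionUpgrade : Sig.stub_contractionUpgrade := by
  sorry

/-! ### Composition -/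

/-- **The line closes the crux BY NAME modulo the two registered stubs.** From stub 1 take the
Navier–Stokes family, the classes `𝒮 j ∋ h` and the uniform `(τ, δ)`; stub 2 turns `(τ, δ)` into ONE
pair `(C, γ)`, valid at every level `j` because it depends on `(τ, δ)` only; specialise its conclusion
at level `j` to `κ = ν j`, `u = v j`, `𝒮 = 𝒮 j`, datum `h ∈ 𝒮 j` — that is (U_h). [bookkeeping] -/
theorem RelaxingFamily_of :
    Sig.stub_contractingStates → Sig.stub_contractionUpgrade → RelaxingFamily := by
  rintro ⟨g, h, hg, hgd, hgm, hh, hhm, hh0, ν, v₀, v, hν, hνlim, hLH, hbd, hE, 𝒮, τ, δ, hh𝒮, hL2,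
    hτ, hδ0, hδ1, hinv, hcon⟩ hup
  obtain ⟨C, γ, hC, hγ, hrel⟩ := hup τ δ hτ hδ0 hδ1
  refine ⟨g, h, hg, hgd, hgm, hh, hhm, hh0, ν, v₀, v, hν, hνlim, hLH, hbd, hE, C, γ, hC, hγ, ?_⟩
  intro j s hs T θ hθ
  exact hrel (ν j) (v j) (𝒮 j) (hν j) (hbd j) (hL2 j) (hinv j) (hcon j) h (hh𝒮 j) s hs T θ hθ

/-- The skeleton in its final shape (D-0027 §3.3): the crux BY NAME from the two registered stubs; it
becomes the crux proof when the last `stub_*` is discharged (until then it depends on `sorryAx`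
through the stubs only — no `sorry` of its own). -/
theorem RelaxingFamily_proof : RelaxingFamily :=
  RelaxingFamily_of stub_contractingStates stub_contractionUpgrade

end Summit.AnomalousDissipation.AnomalousDissipation.Cruxes.RelaxingFamily.Birth

end
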